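import Literature.Probability.LatticeModels.GridDomainHittingProbabilityProofs
import Literature.Probability.LatticeModels.GridDomainConformalSteps
import Literature.Analysis.Complex.KoebeQuarterProofs
import Mathlib.Analysis.SpecialFunctions.Complex.LogDeriv
import Mathlib.Analysis.SpecialFunctions.Trigonometric.Bounds
import HarnessLib

/-!
# Boundary hitting in grid domains (LSW 2004, Lemma 5.3) — proved steps, V:
# a harmonic-measure barrier in conformal coordinates, and the Koebe radius

Topic `Literature/Probability/LatticeModels`; fifth sibling of `GridDomainHittingProbability.lean`
(the named fact `boundaryHitting`, G. F. Lawler, O. Schramm, W. Werner, *Conformal invariance of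
planar loop-erased random walks and uniform spanning trees*, Ann. Probab. 32 (2004), Lemma 5.3).
The printed proof controls the conformal displacement of the walk before its exit through
"conformal invariance of harmonic measure" for Brownian motion and the convergence of the walk to
Brownian motion. In the tree the same control is obtained from an explicit **harmonic-measure
barrier**, to which the lattice-superharmonicity criterion
`Literature.Analysis.Complex.sqrt_im_fourPointSum_le` (`HarmonicSqrtLatticeMean.lean`) applies.
This file constructs the barrier and proves its three properties.

For a boundary direction `b ∈ ∂𝔻` and a scale `a > 0`:

* `LSWGrid.cayleyAt b ζ = i (b - ζ)/(b + ζ)` maps `𝔻` onto the upper half-plane `ℍ` with `b ↦ 0`,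
  `im (cayleyAt b ζ) = (1 - |ζ|²)/|b + ζ|²` (`cayleyAt_im`), `|b - ζ| ≤ 2 |cayleyAt b ζ|`;
* `LSWGrid.hmRatio a z = (z - a)/(z + a)` (`ℍ → ℍ`), whose argument is `π ×` the harmonic measure of
  the segment `[-a, a]` seen from `z`; `LSWGrid.uhpBarrier a z = 1 - arg (hmRatio a z)/π ∈ (0, 1)`
  is the harmonic measure of `ℝ ∖ [-a, a]`, it is `< 1/2` exactly on the half-disc `|z| < a`
  (`uhpBarrier_lt_half_iff`), and there `uhpBarrier a z ≤ a · im z/(|z - a| |z + a|)` (Jordan's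
  inequality; `uhpBarrier_le_of_norm_lt`);
* `LSWGrid.barrierQ b a ψ = i - π⁻¹ log (hmRatio a (cayleyAt b ∘ ψ))`, holomorphic on `D` for a disc
  map `ψ` with `im (barrierQ b a ψ x) = uhpBarrier a (cayleyAt b (ψ x))` (`barrierQ_im`);
* `LSWGrid.koebeRadius ψ x = (1 - |ψ x|²)/(4 |ψ'(x)|)`: **`B(x, koebeRadius ψ x) ⊆ D`** (Koebe's
  one-quarter theorem at a general point, `koebeQuarter_holds`; `ball_koebeRadius_subset`) and
  `s ≤ 4 koebeRadius ψ x` whenever `B(x, s) ⊆ D` (Schwarz–Pick; `le_four_mul_koebeRadius`);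
* the **relative gradient bound** `uhpBarrier < 1/2 ⟹ im (barrierQ) ≤ π |barrierQ'| · koebeRadius`
  (`barrierQ_im_le_mul_norm_deriv`), the hypothesis of `sqrt_im_fourPointSum_le` with `c = 1/π`.

Everything here is proved; the four definitions are explicit formulas, no named fact is introduced.

## References

* G. F. Lawler, O. Schramm, W. Werner, Ann. Probab. 32 (2004) 939–995, §5.1 [LawlerSchrammWerner2004].
* Ch. Pommerenke, *Boundary Behaviour of Conformal Maps*, Springer (1992), Cor. 1.4 (Koebe at a
  general point) [PommerenkeBBCM1992].
* J. B. Garnett, D. E. Marshall, *Harmonic Measure*, CUP (2005), Ch. I §1 (harmonic measure of an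
  interval in `ℍ` is the angle it subtends, divided by `π`).
-/

noncomputable section

open Set Metric Complex Filter
open scoped Real Topology ComplexConjugate

namespace Literature.Probability.LatticeModels

namespace LSWGrid

/-! ### The Cayley map at a boundary point -/

/-- The Cayley-type map of the unit disc onto the upper half-plane sending the boundary point `b`
to `0` and `-b` to `∞`: `cayleyAt b ζ = i (b - ζ)/(b + ζ)`. [folklore] -/
def cayleyAt (b ζ : ℂ) : ℂ := I * (b - ζ) / (b + ζ)

section Cayley

variable {b ζ : ℂ}

/-- `b + ζ ≠ 0` for `|b| = 1 > |ζ|`. [folklore] -/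
theorem add_ne_zero_of_norm_lt (hb : ‖b‖ = 1) (hζ : ‖ζ‖ < 1) : b + ζ ≠ 0 := by
  intro h
  have : b = -ζ := eq_neg_of_add_eq_zero_left h
  rw [this, norm_neg] at hb
  linarith

/-- `|b + ζ| ≤ 2`. [folklore] -/
theorem norm_add_le_two (hb : ‖b‖ = 1) (hζ : ‖ζ‖ < 1) : ‖b + ζ‖ ≤ 2 := by
  linarith [norm_add_le b ζ]

/-- **The height in the half-plane**: `im (cayleyAt b ζ) = (1 - |ζ|²)/|b + ζ|²`. [folklore] -/
theorem cayleyAt_im (hb : ‖b‖ = 1) (hζ : ‖ζ‖ < 1) :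
    (cayleyAt b ζ).im = (1 - ‖ζ‖ ^ 2) / ‖b + ζ‖ ^ 2 := by
  have hne := add_ne_zero_of_norm_lt hb hζ
  have hb2 : b.re ^ 2 + b.im ^ 2 = 1 := by
    have := Complex.sq_norm b; rw [hb, Complex.normSq_apply] at this; nlinarith
  rw [cayleyAt, div_im, Complex.sq_norm, Complex.sq_norm, Complex.normSq_apply ζ]
  have hns : normSq (b + ζ) ≠ 0 := by rwa [Ne, Complex.normSq_eq_zero]
  field_simp
  simp only [mul_re, mul_im, I_re, I_im, sub_re, sub_im, add_re, add_im]
  nlinarith [hb2]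

/-- `cayleyAt b` maps the disc into the upper half-plane. [folklore] -/
theorem cayleyAt_im_pos (hb : ‖b‖ = 1) (hζ : ‖ζ‖ < 1) : 0 < (cayleyAt b ζ).im := by
  rw [cayleyAt_im hb hζ]
  refine div_pos ?_ (pow_pos (norm_pos_iff.2 (add_ne_zero_of_norm_lt hb hζ)) 2)
  nlinarith [norm_nonneg ζ]

/-- `|b - ζ| = |cayleyAt b ζ| |b + ζ| ≤ 2 |cayleyAt b ζ|`. [folklore] -/
theorem norm_sub_le_two_mul_norm_cayleyAt (hb : ‖b‖ = 1) (hζ : ‖ζ‖ < 1) :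
    ‖b - ζ‖ ≤ 2 * ‖cayleyAt b ζ‖ := by
  have hne := add_ne_zero_of_norm_lt hb hζ
  have heq : ‖b - ζ‖ = ‖cayleyAt b ζ‖ * ‖b + ζ‖ := by
    rw [cayleyAt, norm_div, norm_mul, Complex.norm_I, one_mul, div_mul_cancel₀ _ (norm_ne_zero_iff.2 hne)]
  rw [heq]
  calc ‖cayleyAt b ζ‖ * ‖b + ζ‖ ≤ ‖cayleyAt b ζ‖ * 2 :=
        mul_le_mul_of_nonneg_left (norm_add_le_two hb hζ) (norm_nonneg _)
    _ = 2 * ‖cayleyAt b ζ‖ := by ring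

/-- The derivative of `cayleyAt b`: `-2 i b/(b + ζ)²`. [folklore] -/
theorem hasDerivAt_cayleyAt (hne : b + ζ ≠ 0) :
    HasDerivAt (cayleyAt b) (-(2 * I * b) / (b + ζ) ^ 2) ζ := by
  have h1 : HasDerivAt (fun z => I * (b - z)) (-I) ζ := by
    simpa using ((hasDerivAt_id ζ).const_sub b).const_mul I
  have h2 : HasDerivAt (fun z => b + z) 1 ζ := by simpa using (hasDerivAt_id ζ).const_add b
  have h : HasDerivAt (fun z => I * (b - z) / (b + z)) _ ζ := h1.div h2 hne
  exact h.congr_deriv (by ring)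

/-- `|cayleyAt' (ζ)| = 2/|b + ζ|²`. [folklore] -/
theorem norm_deriv_cayleyAt (hb : ‖b‖ = 1) (hζ : ‖ζ‖ < 1) :
    ‖deriv (cayleyAt b) ζ‖ = 2 / ‖b + ζ‖ ^ 2 := by
  have hne := add_ne_zero_of_norm_lt hb hζ
  rw [(hasDerivAt_cayleyAt hne).deriv, norm_div, norm_neg, norm_pow, norm_mul, norm_mul,
    Complex.norm_I, hb, Complex.norm_two]
  ring

/-- **Height and derivative**: `|cayleyAt'(ζ)| (1 - |ζ|²) = 2 im (cayleyAt b ζ)`. [folklore] -/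
theorem norm_deriv_cayleyAt_mul (hb : ‖b‖ = 1) (hζ : ‖ζ‖ < 1) :
    ‖deriv (cayleyAt b) ζ‖ * (1 - ‖ζ‖ ^ 2) = 2 * (cayleyAt b ζ).im := by
  have hne := add_ne_zero_of_norm_lt hb hζ
  have hpos : 0 < ‖b + ζ‖ ^ 2 := pow_pos (norm_pos_iff.2 hne) 2
  rw [norm_deriv_cayleyAt hb hζ, cayleyAt_im hb hζ]
  field_simp

/-- The value at the points `(1 - η) b` of the radius through `b`: `cayleyAt b ((1-η) b) = i η/(2-η)`.
[folklore] -/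
theorem cayleyAt_radial (hb : ‖b‖ = 1) {η : ℝ} (hη : η < 2) :
    cayleyAt b ((1 - η : ℝ) * b) = I * (η / (2 - η) : ℝ) := by
  have hb0 : b ≠ 0 := by rintro rfl; simp at hb
  have h2 : ((2 - η : ℝ) : ℂ) ≠ 0 := by exact_mod_cast (by linarith : (2 - η : ℝ) ≠ 0)
  rw [cayleyAt]
  have hden : b + ((1 - η : ℝ) : ℂ) * b = ((2 - η : ℝ) : ℂ) * b := by push_cast; ring
  have hnum : b - ((1 - η : ℝ) : ℂ) * b = (η : ℂ) * b := by push_cast; ring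
  rw [hden, hnum, ← mul_assoc, mul_div_mul_right _ _ hb0, mul_div_assoc]
  push_cast
  ring

end Cayley

/-! ### The harmonic measure of `ℝ ∖ [-a, a]` in the upper half-plane -/

/-- `hmRatio a z = (z - a)/(z + a)`; for `z ∈ ℍ` its argument is the angle subtended at `z` by the
segment `[-a, a]`, i.e. `π ×` the harmonic measure of `[-a, a]` in `ℍ` seen from `z`. [folklore] -/
def hmRatio (a : ℝ) (z : ℂ) : ℂ := (z - a) / (z + a)

/-- **The barrier function in the half-plane**: `uhpBarrier a z = 1 - arg ((z-a)/(z+a))/π`, the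
harmonic measure of `ℝ ∖ [-a, a]` in `ℍ` seen from `z`. [folklore] -/
def uhpBarrier (a : ℝ) (z : ℂ) : ℝ := 1 - arg (hmRatio a z) / π

section HalfPlane

variable {a : ℝ} {z : ℂ}

/-- `z + a ≠ 0` for `z ∈ ℍ`. [folklore] -/
theorem add_real_ne_zero (hz : 0 < z.im) (a : ℝ) : z + a ≠ 0 := by
  intro h; have := congrArg Complex.im h; simp at this; linarith

/-- `z - a ≠ 0` for `z ∈ ℍ`. [folklore] -/
theorem sub_real_ne_zero (hz : 0 < z.im) (a : ℝ) : z - a ≠ 0 := by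
  intro h; have := congrArg Complex.im h; simp at this; linarith

/-- `im ((z-a)/(z+a)) = 2 a im z/|z + a|²`. [folklore] -/
theorem hmRatio_im (hz : 0 < z.im) (a : ℝ) : (hmRatio a z).im = 2 * a * z.im / ‖z + a‖ ^ 2 := by
  have hne := add_real_ne_zero hz a
  have hns : normSq (z + a) ≠ 0 := by rwa [Ne, Complex.normSq_eq_zero]
  rw [hmRatio, div_im, Complex.sq_norm]
  field_simp
  simp only [sub_re, sub_im, add_re, add_im, ofReal_re, ofReal_im]
  ring

/-- `re ((z-a)/(z+a)) = (|z|² - a²)/|z + a|²`. [folklore] -/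
theorem hmRatio_re (hz : 0 < z.im) (a : ℝ) : (hmRatio a z).re = (‖z‖ ^ 2 - a ^ 2) / ‖z + a‖ ^ 2 := by
  have hne := add_real_ne_zero hz a
  have hns : normSq (z + a) ≠ 0 := by rwa [Ne, Complex.normSq_eq_zero]
  rw [hmRatio, div_re, Complex.sq_norm, Complex.sq_norm, Complex.normSq_apply z]
  field_simp
  simp only [sub_re, sub_im, add_re, add_im, ofReal_re, ofReal_im]
  ring

/-- `hmRatio a` maps `ℍ` into `ℍ` for `a > 0`. [folklore] -/
theorem hmRatio_im_pos (ha : 0 < a) (hz : 0 < z.im) : 0 < (hmRatio a z).im := by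
  rw [hmRatio_im hz]
  exact div_pos (by positivity) (pow_pos (norm_pos_iff.2 (add_real_ne_zero hz a)) 2)

/-- `hmRatio a z ≠ 0`. [folklore] -/
theorem hmRatio_ne_zero (ha : 0 < a) (hz : 0 < z.im) : hmRatio a z ≠ 0 := fun h => by
  have := hmRatio_im_pos ha hz; rw [h] at this; simp at this

/-- `hmRatio a z` lies in the slit plane. [folklore] -/
theorem hmRatio_mem_slitPlane (ha : 0 < a) (hz : 0 < z.im) : hmRatio a z ∈ slitPlane :=
  Or.inr (hmRatio_im_pos ha hz).ne'

/-- `0 < arg (hmRatio a z) < π`. [folklore] -/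
theorem arg_hmRatio_mem_Ioo (ha : 0 < a) (hz : 0 < z.im) : arg (hmRatio a z) ∈ Ioo 0 π := by
  have him := hmRatio_im_pos ha hz
  refine ⟨lt_of_le_of_ne (arg_nonneg_iff.2 him.le) fun h => ?_, arg_lt_pi_iff.2 (Or.inr him.ne')⟩
  have := arg_eq_zero_iff.1 h.symm
  exact him.ne' this.2

/-- `0 < uhpBarrier a z < 1` on `ℍ`. [folklore] -/
theorem uhpBarrier_mem_Ioo (ha : 0 < a) (hz : 0 < z.im) : uhpBarrier a z ∈ Ioo 0 1 := by
  obtain ⟨h0, hπ⟩ := arg_hmRatio_mem_Ioo ha hz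
  refine ⟨?_, ?_⟩
  · rw [uhpBarrier, sub_pos, div_lt_one Real.pi_pos]; exact hπ
  · rw [uhpBarrier, sub_lt_self_iff]; exact div_pos h0 Real.pi_pos

/-- **The level set `1/2` is the half-circle `|z| = a`**: `uhpBarrier a z < 1/2 ↔ |z| < a` (Thales:
the segment `[-a, a]` subtends a right angle exactly on the circle with this diameter). [folklore] -/
theorem uhpBarrier_lt_half_iff (ha : 0 < a) (hz : 0 < z.im) : uhpBarrier a z < 1 / 2 ↔ ‖z‖ < a := by
  have him := hmRatio_im_pos ha hz
  have hiff : uhpBarrier a z < 1 / 2 ↔ π / 2 < arg (hmRatio a z) := by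
    rw [uhpBarrier]
    constructor
    · intro h
      have : 1 / 2 < arg (hmRatio a z) / π := by linarith
      rw [lt_div_iff₀ Real.pi_pos] at this; linarith
    · intro h
      have : 1 / 2 < arg (hmRatio a z) / π := by rw [lt_div_iff₀ Real.pi_pos]; linarith
      linarith
  rw [hiff, ← not_le, arg_le_pi_div_two_iff, not_or, not_le, not_lt, hmRatio_re hz]
  have hpos : 0 < ‖z + a‖ ^ 2 := pow_pos (norm_pos_iff.2 (add_real_ne_zero hz a)) 2
  rw [div_lt_iff₀ hpos, zero_mul, sub_neg, pow_lt_pow_iff_left₀ (norm_nonneg z) ha.le two_ne_zero]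
  exact ⟨fun h => h.1, fun h => ⟨h, him.le⟩⟩

/-- **Jordan's inequality for the barrier**: on the half-disc `|z| < a`,
`uhpBarrier a z ≤ a · im z/(|z - a| |z + a|)` (`π uhpBarrier = π - arg χ ≤ (π/2) sin (arg χ)`
with `sin (arg χ) = im χ/|χ| = 2 a im z/(|z - a| |z + a|)`, `χ = hmRatio a z`). [folklore] -/
theorem uhpBarrier_le_of_norm_lt (ha : 0 < a) (hz : 0 < z.im) (h : ‖z‖ < a) :
    uhpBarrier a z ≤ a * z.im / (‖z - a‖ * ‖z + a‖) := by
  set χ := hmRatio a z with hχ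
  have him := hmRatio_im_pos ha hz
  have hχ0 : χ ≠ 0 := hmRatio_ne_zero ha hz
  have hre : χ.re < 0 := by
    rw [hχ, hmRatio_re hz, div_lt_iff₀ (pow_pos (norm_pos_iff.2 (add_real_ne_zero hz a)) 2),
      zero_mul, sub_neg]
    exact pow_lt_pow_left₀ h (norm_nonneg z) two_ne_zero
  -- `π/2 < arg χ ≤ π`
  have hgt : π / 2 < arg χ := by
    by_contra hle
    rcases arg_le_pi_div_two_iff.1 (not_lt.1 hle) with h' | h'
    · linarith
    · linarith
  have hle : arg χ ≤ π := arg_le_pi χ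
  -- Jordan: `(2/π) (π - arg χ) ≤ sin (π - arg χ) = sin (arg χ) = im χ/|χ|`
  have hJ := Real.mul_le_sin (x := π - arg χ) (by linarith) (by linarith)
  rw [Real.sin_pi_sub, Complex.sin_arg] at hJ
  have hU : uhpBarrier a z = (π - arg χ) / π := by
    rw [uhpBarrier, ← hχ]; field_simp
  have hratio : χ.im / ‖χ‖ = 2 * a * z.im / (‖z - a‖ * ‖z + a‖) := by
    have hn : ‖χ‖ = ‖z - a‖ / ‖z + a‖ := by rw [hχ, hmRatio, norm_div]
    have h1 : 0 < ‖z - a‖ := norm_pos_iff.2 (sub_real_ne_zero hz a)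
    have h2 : 0 < ‖z + a‖ := norm_pos_iff.2 (add_real_ne_zero hz a)
    rw [hn, hχ, hmRatio_im hz]
    field_simp
  rw [hU, div_le_iff₀ Real.pi_pos]
  rw [hratio] at hJ
  have hπ := Real.pi_pos
  have key : π - arg χ ≤ π / 2 * (2 * a * z.im / (‖z - ↑a‖ * ‖z + ↑a‖)) := by
    have := mul_le_mul_of_nonneg_left hJ (by positivity : (0 : ℝ) ≤ π / 2)
    calc π - arg χ = π / 2 * (2 / π * (π - arg χ)) := by field_simp
      _ ≤ _ := this
  calc π - arg χ ≤ π / 2 * (2 * a * z.im / (‖z - ↑a‖ * ‖z + ↑a‖)) := key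
    _ = a * z.im / (‖z - ↑a‖ * ‖z + ↑a‖) * π := by ring

/-- The derivative of `hmRatio a`: `2a/(z + a)²`. [folklore] -/
theorem hasDerivAt_hmRatio (hne : z + a ≠ 0) : HasDerivAt (hmRatio a) (2 * a / (z + a) ^ 2) z := by
  have h1 : HasDerivAt (fun w : ℂ => w - a) 1 z := (hasDerivAt_id z).sub_const _
  have h2 : HasDerivAt (fun w : ℂ => w + a) 1 z := (hasDerivAt_id z).add_const _
  have h : HasDerivAt (fun w : ℂ => (w - a) / (w + a)) _ z := h1.div h2 hne
  exact h.congr_deriv (by field_simp; ring)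

end HalfPlane

/-! ### The barrier in `D` -/

/-- **The barrier**: `barrierQ b a ψ = i - π⁻¹ log ((T ψ - a)/(T ψ + a))`, `T = cayleyAt b`, a
holomorphic function on `D` whose imaginary part is the harmonic measure, transported by the
disc map `ψ` and `T`, of the complement of the boundary segment `[-a, a] ⊆ ∂ℍ`. [folklore] -/
def barrierQ (b : ℂ) (a : ℝ) (ψ : ℂ → ℂ) (x : ℂ) : ℂ :=
  I - (π : ℂ)⁻¹ * log (hmRatio a (cayleyAt b (ψ x)))

/-- **The Koebe radius** of a disc map at `x`: `(1 - |ψ x|²)/(4 |ψ'(x)|)`, a quarter of the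
conformal radius of `D` at `x`. [folklore] -/
def koebeRadius (ψ : ℂ → ℂ) (x : ℂ) : ℝ := (1 - ‖ψ x‖ ^ 2) / (4 * ‖deriv ψ x‖)

section Barrier

variable {b : ℂ} {a : ℝ} {ψ : ℂ → ℂ} {D : Set ℂ} {x : ℂ}

/-- `im (barrierQ b a ψ x) = uhpBarrier a (cayleyAt b (ψ x))`. [folklore] -/
theorem barrierQ_im (b : ℂ) (a : ℝ) (ψ : ℂ → ℂ) (x : ℂ) :
    (barrierQ b a ψ x).im = uhpBarrier a (cayleyAt b (ψ x)) := by
  rw [barrierQ, uhpBarrier, sub_im, I_im, ← ofReal_inv, im_ofReal_mul, log_im]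
  ring

/-- `0 < im (barrierQ) < 1` wherever `|ψ| < 1`. [folklore] -/
theorem barrierQ_im_mem_Ioo (hb : ‖b‖ = 1) (ha : 0 < a) (hψx : ‖ψ x‖ < 1) :
    (barrierQ b a ψ x).im ∈ Ioo 0 1 := by
  rw [barrierQ_im]
  exact uhpBarrier_mem_Ioo ha (cayleyAt_im_pos hb hψx)

/-- **The barrier is holomorphic** on any set mapped into the disc by a holomorphic `ψ`. [folklore] -/
theorem differentiableOn_barrierQ (hb : ‖b‖ = 1) (ha : 0 < a) (hψ : DifferentiableOn ℂ ψ D)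
    (hmaps : ∀ x ∈ D, ‖ψ x‖ < 1) : DifferentiableOn ℂ (barrierQ b a ψ) D := by
  intro x hx
  have hζ := hmaps x hx
  have hne := add_ne_zero_of_norm_lt hb hζ
  have hz := cayleyAt_im_pos hb hζ
  have h2 := (hasDerivAt_cayleyAt hne).differentiableAt
  have h3 := (hasDerivAt_hmRatio (add_real_ne_zero hz a)).differentiableAt
  have h4 := (Complex.hasDerivAt_log (hmRatio_mem_slitPlane ha hz)).differentiableAt
  have h := ((h4.comp _ h3).comp _ h2).comp_differentiableWithinAt x (hψ x hx)
  exact ((h.const_mul ((π : ℂ)⁻¹)).const_sub I).congr (fun y _ => rfl) rfl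

/-- **The derivative of the barrier** (chain rule):
`|barrierQ'(x)| = π⁻¹ · (2a/(|z-a| |z+a|)) · (2/|b+ζ|²) · |ψ'(x)|`, `ζ = ψ x`, `z = cayleyAt b ζ`. [folklore] -/
theorem norm_deriv_barrierQ (hb : ‖b‖ = 1) (ha : 0 < a) (hD : IsOpen D) (hψ : DifferentiableOn ℂ ψ D)
    (hx : x ∈ D) (hψx : ‖ψ x‖ < 1) :
    ‖deriv (barrierQ b a ψ) x‖ = π⁻¹ * (2 * a / (‖cayleyAt b (ψ x) - a‖ * ‖cayleyAt b (ψ x) + a‖)) *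
      (2 / ‖b + ψ x‖ ^ 2) * ‖deriv ψ x‖ := by
  set ζ := ψ x with hζdef
  set z := cayleyAt b ζ with hzdef
  have hne := add_ne_zero_of_norm_lt hb hψx
  have hz := cayleyAt_im_pos hb hψx
  have hza := add_real_ne_zero hz a
  have hza' := sub_real_ne_zero hz a
  have hχ0 := hmRatio_ne_zero ha hz
  have hψ' : HasDerivAt ψ (deriv ψ x) x := (hψ.differentiableAt (hD.mem_nhds hx)).hasDerivAt
  have hT : HasDerivAt (cayleyAt b) (-(2 * I * b) / (b + ζ) ^ 2) (ψ x) := hasDerivAt_cayleyAt hne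
  have hχ : HasDerivAt (hmRatio a) (2 * a / (z + a) ^ 2) (cayleyAt b (ψ x)) := hasDerivAt_hmRatio hza
  have hlog : HasDerivAt log (hmRatio a z)⁻¹ (hmRatio a (cayleyAt b (ψ x))) :=
    Complex.hasDerivAt_log (hmRatio_mem_slitPlane ha hz)
  have hcomp := ((hlog.comp x (hχ.comp x (hT.comp x hψ'))).const_mul ((π : ℂ)⁻¹)).const_sub I
  have hQ : HasDerivAt (barrierQ b a ψ)
      (-((π : ℂ)⁻¹ * ((hmRatio a z)⁻¹ * (2 * a / (z + a) ^ 2 * (-(2 * I * b) / (b + ζ) ^ 2 * deriv ψ x))))) x :=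
    hcomp.congr_of_eventuallyEq (Eventually.of_forall fun y => rfl)
  rw [hQ.deriv]
  simp only [norm_neg, norm_mul, norm_inv, norm_div, norm_pow, Complex.norm_I, hb, Complex.norm_real,
    Real.norm_of_nonneg Real.pi_pos.le, Complex.norm_two, Real.norm_of_nonneg ha.le, mul_one]
  have hn : ‖hmRatio a z‖ = ‖z - a‖ / ‖z + a‖ := by rw [hmRatio, norm_div]
  rw [hn]
  have h1 : 0 < ‖z - a‖ := norm_pos_iff.2 hza'
  have h2 : 0 < ‖z + a‖ := norm_pos_iff.2 hza
  field_simp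

/-- **The relative gradient bound.** Where the barrier is below `1/2`,
`im (barrierQ b a ψ x) ≤ π · |barrierQ'(x)| · koebeRadius ψ x` (provided `ψ'(x) ≠ 0`). [folklore] -/
theorem barrierQ_im_le_mul_norm_deriv (hb : ‖b‖ = 1) (ha : 0 < a) (hD : IsOpen D)
    (hψ : DifferentiableOn ℂ ψ D) (hx : x ∈ D) (hψx : ‖ψ x‖ < 1) (hψ' : deriv ψ x ≠ 0)
    (hU : (barrierQ b a ψ x).im < 1 / 2) :
    (barrierQ b a ψ x).im ≤ π * ‖deriv (barrierQ b a ψ) x‖ * koebeRadius ψ x := by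
  have hz := cayleyAt_im_pos hb hψx
  rw [barrierQ_im] at hU ⊢
  have hlt := (uhpBarrier_lt_half_iff ha hz).1 hU
  have hbound := uhpBarrier_le_of_norm_lt ha hz hlt
  rw [norm_deriv_barrierQ hb ha hD hψ hx hψx, koebeRadius]
  have hne := add_ne_zero_of_norm_lt hb hψx
  have hza := add_real_ne_zero hz a
  have hza' := sub_real_ne_zero hz a
  have h1 : 0 < ‖cayleyAt b (ψ x) - a‖ := norm_pos_iff.2 hza'
  have h2 : 0 < ‖cayleyAt b (ψ x) + a‖ := norm_pos_iff.2 hza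
  have h3 : 0 < ‖b + ψ x‖ := norm_pos_iff.2 hne
  have h4 : 0 < ‖deriv ψ x‖ := norm_pos_iff.2 hψ'
  have him : (cayleyAt b (ψ x)).im = (1 - ‖ψ x‖ ^ 2) / ‖b + ψ x‖ ^ 2 := cayleyAt_im hb hψx
  refine hbound.trans (le_of_eq ?_)
  rw [him]
  field_simp
  ring

end Barrier

/-! ### The Koebe radius -/

section Koebe

variable {D : Set ℂ} {ψ : ℂ → ℂ} {x : ℂ}

/-- **Koebe's one-quarter theorem at a general point, for a disc map**: the disc of radius
`koebeRadius ψ x = (1 - |ψ x|²)/(4|ψ'(x)|)` about `x ∈ D` lies in `D` (apply `koebeQuarter_holds` to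
`ψ⁻¹ ∘ discMobius (-ψ x)`). [cite: PommerenkeBBCM1992, Cor. 1.4] -/
theorem ball_koebeRadius_subset (hD : IsOpen D) (hψ : IsDiscMap D ψ) (hx : x ∈ D) :
    ball x (koebeRadius ψ x) ⊆ D := by
  set φ := Function.invFunOn ψ D with hφ
  set ζ := ψ x with hζ
  have hζ1 : ‖ζ‖ < 1 := hψ.norm_lt_one hx
  have hζ1' : ‖-ζ‖ < 1 := by rwa [norm_neg]
  have hφd : DifferentiableOn ℂ φ (ball 0 1) := hψ.differentiableOn_inv hD
  have hφinj : InjOn φ (ball 0 1) := hψ.injOn_inv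
  have hφim : φ '' ball 0 1 = D := hψ.image_inv
  set m : ℂ → ℂ := Complex.discMobius (-ζ) with hm
  have hmmaps : MapsTo m (ball 0 1) (ball 0 1) := Complex.mapsTo_discMobius hζ1'
  have hmd : DifferentiableOn ℂ m (ball 0 1) := Complex.differentiableOn_discMobius hζ1'
  have hminj : InjOn m (ball 0 1) := Complex.injOn_discMobius hζ1'
  have hm0 : m 0 = ζ := by simp [hm, Complex.discMobius_apply]
  set f : ℂ → ℂ := fun z ↦ φ (m z) with hf
  have hfd : DifferentiableOn ℂ f (ball 0 1) := hφd.comp hmd hmmaps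
  have hfinj : InjOn f (ball 0 1) := hφinj.comp hminj hmmaps
  have hK := Literature.Analysis.Complex.koebeQuarter_holds f hfd hfinj
  have hf0 : f 0 = x := by simp only [hf, hm0, hζ]; exact hψ.leftInvOn hx
  have hζmem : ζ ∈ ball (0 : ℂ) 1 := mem_ball_zero_iff.2 hζ1
  -- the derivative of the inverse at `ζ = ψ x`
  have hψ'ne : ∀ z ∈ D, deriv ψ z ≠ 0 := fun z hz =>
    Literature.Analysis.Complex.SCV.deriv_ne_zero_of_injOn hψ.1 hD hψ.2.1.injOn hz
  have hφ' : HasDerivAt φ (deriv ψ x)⁻¹ ζ :=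
    (Complex.hasStrictDerivAt_invFunOn hD hψ.1 hψ.2.1.injOn hψ'ne hx).hasDerivAt
  have hderiv : deriv f 0 = (deriv ψ x)⁻¹ * (1 - conj (-ζ) * (-ζ)) := by
    have h1 : HasDerivAt m (deriv m 0) 0 :=
      (hmd.differentiableAt (ball_mem_nhds 0 one_pos)).hasDerivAt
    have h2 : HasDerivAt φ (deriv ψ x)⁻¹ (m 0) := by rw [hm0]; exact hφ'
    rw [show f = φ ∘ m from rfl, (h2.comp 0 h1).deriv, Complex.deriv_discMobius_zero]
  have hnorm : ‖deriv f 0‖ = (1 - ‖ζ‖ ^ 2) / ‖deriv ψ x‖ := by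
    rw [hderiv, map_neg, neg_mul_neg, norm_mul, Complex.norm_one_sub_conj_mul_self hζ1, norm_inv]
    ring
  have hrad : ‖deriv f 0‖ / 4 = koebeRadius ψ x := by
    rw [hnorm, koebeRadius, hζ]; ring
  rw [hf0, hrad] at hK
  refine hK.trans ?_
  rintro _ ⟨z, hz, rfl⟩
  rw [← hφim]
  exact ⟨m z, hmmaps hz, rfl⟩

/-- **Schwarz–Pick from below for the Koebe radius**: if `ψ` maps the disc `B(x, s)`
holomorphically into the unit disc then `s ≤ 4 koebeRadius ψ x` (`|ψ'(x)| ≤ (1 - |ψ x|²)/s`). [folklore] -/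
theorem le_four_mul_koebeRadius {s : ℝ} (hs : 0 < s) (hψ : DifferentiableOn ℂ ψ (ball x s))
    (hmaps : MapsTo ψ (ball x s) (ball 0 1)) (hψ' : deriv ψ x ≠ 0) : s ≤ 4 * koebeRadius ψ x := by
  set a := ψ x with ha
  have ha1 : ‖a‖ < 1 := by simpa using hmaps (mem_ball_self hs)
  set g : ℂ → ℂ := fun z => Complex.discMobius a (ψ z) with hg
  have hgd : DifferentiableOn ℂ g (ball x s) :=
    (Complex.differentiableOn_discMobius ha1).comp hψ hmaps
  have hg0 : g x = 0 := by
    simp only [hg]; exact (Complex.discMobius_eq_zero_iff ha1 ha1.le).2 ha.symm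
  have hgmaps : MapsTo g (ball x s) (closedBall (g x) 1) := by
    intro z hz
    rw [hg0]
    exact ball_subset_closedBall (Complex.mapsTo_discMobius ha1 (hmaps hz))
  have hS := Complex.norm_deriv_le_div_of_mapsTo_ball hgd hgmaps hs
  have hψx : HasDerivAt ψ (deriv ψ x) x := (hψ.differentiableAt (ball_mem_nhds x hs)).hasDerivAt
  have hm : HasDerivAt (Complex.discMobius a) (deriv (Complex.discMobius a) a) (ψ x) := by
    rw [← ha]
    exact (Complex.differentiableAt_discMobius ha1 ha1.le).hasDerivAt
  have hderiv : deriv g x = deriv (Complex.discMobius a) a * deriv ψ x := by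
    rw [show g = Complex.discMobius a ∘ ψ from rfl, (hm.comp x hψx).deriv]
  rw [hderiv, Complex.deriv_discMobius_self ha1, norm_mul, norm_div, norm_one,
    Complex.norm_one_sub_conj_mul_self ha1] at hS
  have h1 : 0 < 1 - ‖a‖ ^ 2 := by nlinarith [norm_nonneg a]
  have h4 : 0 < ‖deriv ψ x‖ := norm_pos_iff.2 hψ'
  rw [koebeRadius, ← ha]
  rw [one_div_mul_eq_div, div_le_div_iff₀ h1 hs, one_mul] at hS
  rw [show 4 * ((1 - ‖a‖ ^ 2) / (4 * ‖deriv ψ x‖)) = (1 - ‖a‖ ^ 2) / ‖deriv ψ x‖ by field_simp,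
    le_div_iff₀ h4]
  linarith

end Koebe

end LSWGrid

end Literature.Probability.LatticeModels
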